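import Summits.PneNP.PneNP.Theorems.SingleThreshold.Negative.Independence
import Literature.Computability.Complexity.CliqueThresholdBounds

/-!
# `SingleThreshold` (stmt-PneNP-2833) — negative-side lemmas V: below `n²` gates the crux holds by
locality (where its content starts)

* `pEq`, `pNe`, `pTouch` and their calculus (`pNe_triangle`, `pEq_le_pEq_add_pNe`,
  `pNe_eq_of_indep`, `min_le_pNe_of_indep`) — probabilities of Boolean events by name.
* `err_ge_of_reads` — **locality lower bound**: if `C` reads only edges in `F` then
  `Pr[C ≠ CLIQUE_k] ≥ min(Pr[CLIQUE_k = 0], Pr[CLIQUE_k = 1] - τ) - τ`, `τ = Pr[some k-clique touches F]`,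
  because `C` is independent of the `F`-blind indicator `CLIQUE_k(x ∖ F)`.
* `touchBudget_le`, `lowerBoundAt_of_le_one` — **for `c ≤ 1` and EVERY `k ≥ 3` there is `δ > 0` with
  `LowerBoundAt c k δ`**: a monotone circuit of size `≤ n^c`, `c ≤ 1`, reads `o(n²)` edges, which
  w.h.p. touch no `k`-clique of the critical `G(n, p_c)`, so it errs w.p. `≥ η_k/2` (`η_k` the in-tree
  lower bound on `Pr[ω_k = 1]`, `eventually_le_gnpProb_cliqueCount_eq_one`). Consequence for the crux
  `∀ c ∃ k ∃ δ, LowerBoundAt c k δ`: the instances `c ≤ 1` are free; content (and any refutation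
  attempt) starts at `c = 2`, i.e. with genuinely global computation (≥ n² gates, counting).

Refuter seat cdisprove-stmt-PneNP-2833 (gen 1), 2026-08-16.
-/

namespace Summit.PneNP.PneNP.Theorems.SingleThreshold.Negative

open Literature.Computability.Complexity Finset Filter Classical

noncomputable section

/-! ### The locality lower bound on the error of a circuit reading few edges -/

/-- Switch off the edges in `F`. [folklore] -/
def zeroOn {n : ℕ} (F : Finset (Edges n)) (x : Edges n → Bool) : Edges n → Bool :=
  fun e => if e ∈ F then false else x e

/-- Bookkeeping. [folklore] -/
theorem zeroOn_le {n : ℕ} (F : Finset (Edges n)) (x : Edges n → Bool) : zeroOn F x ≤ x := by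
  intro e
  unfold zeroOn
  split_ifs
  · exact Bool.false_le _
  · exact le_rfl

/-- Bookkeeping. [folklore] -/
theorem zeroOn_congr_off {n : ℕ} {F : Finset (Edges n)} {x y : Edges n → Bool}
    (h : ∀ e ∉ F, x e = y e) : zeroOn F x = zeroOn F y := by
  funext e
  unfold zeroOn
  split_ifs with he
  · rfl
  · exact h e he

/-- If `x` has a `k`-clique and no `k`-clique of `x` touches `F`, then `x` minus `F` still has a
`k`-clique. [folklore] -/
theorem cliqueFn_zeroOn_eq_true {n k : ℕ} (F : Finset (Edges n)) (x : Edges n → Bool)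
    (hx : cliqueFn n k x = true) (hT : ¬ Touch n k F x) : cliqueFn n k (zeroOn F x) = true := by
  rw [cliqueFn_eq_true_iff_exists] at hx ⊢
  obtain ⟨S, hS, hlive⟩ := hx
  refine ⟨S, hS, fun e he => ?_⟩
  have hxe := hlive e he
  unfold zeroOn
  split_ifs with heF
  · exfalso
    apply hT
    refine ⟨S, mem_powersetCard.2 ⟨subset_univ _, hS⟩, fun e' he' => hlive e' ?_, e, heF, ?_⟩
    · exact (cliqueVec_eq_true_iff S e').1 he'
    · exact (cliqueVec_eq_true_iff S e).2 he
  · exact hxe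

/-- `CLIQUE(x ∖ F) ≠ CLIQUE(x)` forces a clique touching `F`. [folklore] -/
theorem touch_of_ne {n k : ℕ} (F : Finset (Edges n)) (x : Edges n → Bool)
    (h : cliqueFn n k (zeroOn F x) ≠ cliqueFn n k x) : Touch n k F x := by
  by_contra hT
  have hle : cliqueFn n k (zeroOn F x) ≤ cliqueFn n k x := cliqueFn_monotone_holds n k (zeroOn_le F x)
  cases hx : cliqueFn n k x
  · rw [hx] at hle h
    exact h (le_antisymm hle (Bool.false_le _))
  · exact h (by rw [cliqueFn_zeroOn_eq_true F x hx hT, hx])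

/-! ### Probabilities of Boolean events, by name (keeps unification cheap) -/

/-- `Pr[f(G) = b]`. [folklore] -/
def pEq (n : ℕ) (q : ℝ) (f : (Edges n → Bool) → Bool) (b : Bool) : ℝ :=
  gnpProb n q (univ.filter fun x => f x = b)

/-- `Pr[f(G) ≠ g(G)]`. [folklore] -/
def pNe (n : ℕ) (q : ℝ) (f g : (Edges n → Bool) → Bool) : ℝ :=
  gnpProb n q (univ.filter fun x => f x ≠ g x)

/-- `Pr[some k-clique of G touches F]`. [folklore] -/
def pTouch (n k : ℕ) (q : ℝ) (F : Finset (Edges n)) : ℝ :=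
  gnpProb n q (univ.filter fun x => Touch n k F x)

/-- Bookkeeping. [folklore] -/
theorem pEq_nonneg {n : ℕ} {q : ℝ} (hq0 : 0 ≤ q) (hq1 : q ≤ 1) (f : (Edges n → Bool) → Bool) (b : Bool) :
    0 ≤ pEq n q f b := gnpProb_nonneg hq0 hq1 _

/-- Complementary Boolean events have total probability `1`. [folklore] -/
theorem pEq_true_add_false {n : ℕ} (q : ℝ) (f : (Edges n → Bool) → Bool) :
    pEq n q f true + pEq n q f false = 1 := by
  have h : (univ.filter fun x : Edges n → Bool => f x = false) = (univ.filter fun x => f x = true)ᶜ := by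
    ext x
    simp
  unfold pEq
  rw [h, gnpProb_compl]
  ring

/-- Triangle inequality `Pr[f ≠ g] ≤ Pr[f ≠ h] + Pr[g ≠ h]`. [folklore] -/
theorem pNe_triangle {n : ℕ} {q : ℝ} (hq0 : 0 ≤ q) (hq1 : q ≤ 1) (f g h : (Edges n → Bool) → Bool) :
    pNe n q f g ≤ pNe n q f h + pNe n q g h := by
  unfold pNe
  have hsub : (univ.filter fun x : Edges n → Bool => f x ≠ g x) ⊆
      (univ.filter fun x => f x ≠ h x) ∪ (univ.filter fun x => g x ≠ h x) := by
    intro x hx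
    simp only [mem_filter, mem_univ, true_and, mem_union] at hx ⊢
    by_contra hcon
    push Not at hcon
    exact hx (hcon.1.trans hcon.2.symm)
  refine (gnpProb_mono hq0 hq1 hsub).trans ?_
  have hh := Finset.sum_union_inter (s₁ := (univ.filter fun x : Edges n → Bool => f x ≠ h x))
    (s₂ := (univ.filter fun x => g x ≠ h x)) (f := gnpWeight n q)
  have h0 := gnpProb_nonneg hq0 hq1 ((univ.filter fun x : Edges n → Bool => f x ≠ h x) ∩
    (univ.filter fun x => g x ≠ h x))
  unfold gnpProb at hh h0 ⊢
  linarith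

/-- `Pr[f = b] ≤ Pr[g = b] + Pr[f ≠ g]`. [folklore] -/
theorem pEq_le_pEq_add_pNe {n : ℕ} {q : ℝ} (hq0 : 0 ≤ q) (hq1 : q ≤ 1) (f g : (Edges n → Bool) → Bool)
    (b : Bool) : pEq n q f b ≤ pEq n q g b + pNe n q g f := by
  unfold pEq pNe
  have hsub : (univ.filter fun x : Edges n → Bool => f x = b) ⊆
      (univ.filter fun x => g x = b) ∪ (univ.filter fun x => g x ≠ f x) := by
    intro x hx
    simp only [mem_filter, mem_univ, true_and, mem_union] at hx ⊢
    by_cases hg : g x = b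
    · exact Or.inl hg
    · right; rw [hx]; exact hg
  refine (gnpProb_mono hq0 hq1 hsub).trans ?_
  have hh := Finset.sum_union_inter (s₁ := (univ.filter fun x : Edges n → Bool => g x = b))
    (s₂ := (univ.filter fun x => g x ≠ f x)) (f := gnpWeight n q)
  have h0 := gnpProb_nonneg hq0 hq1 ((univ.filter fun x : Edges n → Bool => g x = b) ∩
    (univ.filter fun x => g x ≠ f x))
  unfold gnpProb at hh h0 ⊢
  linarith

/-- **Independent predictors**: if `f` reads only `F` and `g` only `Fᶜ`, then
`Pr[f ≠ g] = Pr[f=1]Pr[g=0] + Pr[f=0]Pr[g=1]`. [folklore] -/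
theorem pNe_eq_of_indep {n : ℕ} (q : ℝ) (F : Finset (Edges n)) (f g : (Edges n → Bool) → Bool)
    (hf : ∀ x y : Edges n → Bool, (∀ e ∈ F, x e = y e) → f x = f y)
    (hg : ∀ x y : Edges n → Bool, (∀ e ∉ F, x e = y e) → g x = g y) :
    pNe n q f g = pEq n q f true * pEq n q g false + pEq n q f false * pEq n q g true := by
  classical
  have hsplit : (univ.filter fun x : Edges n → Bool => f x ≠ g x) =
      (univ.filter fun x => f x = true ∧ g x = false) ∪ (univ.filter fun x => f x = false ∧ g x = true) := by
    ext x
    simp only [mem_filter, mem_univ, true_and, mem_union]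
    cases f x <;> cases g x <;> simp
  have hdisj : Disjoint (univ.filter fun x : Edges n → Bool => f x = true ∧ g x = false)
      (univ.filter fun x => f x = false ∧ g x = true) := by
    rw [Finset.disjoint_filter]
    intro x _ h1 h2
    rw [h1.1] at h2
    exact Bool.noConfusion h2.1
  have e1 := gnpProb_and_eq_mul F (fun x => f x = true) (fun x => g x = false)
    (fun x y hxy => by rw [hf x y hxy]) (fun x y hxy => by rw [hg x y hxy]) q
  have e2 := gnpProb_and_eq_mul F (fun x => f x = false) (fun x => g x = true)
    (fun x y hxy => by rw [hf x y hxy]) (fun x y hxy => by rw [hg x y hxy]) q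
  unfold pNe pEq
  rw [hsplit, gnpProb, Finset.sum_union hdisj]
  change gnpProb n q _ + gnpProb n q _ = _
  rw [e1, e2]

/-- A mixture of `Pr[g=0]` and `Pr[g=1]` with weights `Pr[f=1], Pr[f=0]` is at least the minimum.
[folklore] -/
theorem min_le_pNe_of_indep {n : ℕ} {q : ℝ} (hq0 : 0 ≤ q) (hq1 : q ≤ 1) (F : Finset (Edges n))
    (f g : (Edges n → Bool) → Bool)
    (hf : ∀ x y : Edges n → Bool, (∀ e ∈ F, x e = y e) → f x = f y)
    (hg : ∀ x y : Edges n → Bool, (∀ e ∉ F, x e = y e) → g x = g y) :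
    min (pEq n q g false) (pEq n q g true) ≤ pNe n q f g := by
  rw [pNe_eq_of_indep q F f g hf hg]
  have hsum := pEq_true_add_false q f
  have h1 := pEq_nonneg hq0 hq1 f true
  have h0 := pEq_nonneg hq0 hq1 f false
  have ha : pEq n q f true * min (pEq n q g false) (pEq n q g true) ≤ pEq n q f true * pEq n q g false :=
    mul_le_mul_of_nonneg_left (min_le_left _ _) h1
  have hb : pEq n q f false * min (pEq n q g false) (pEq n q g true) ≤ pEq n q f false * pEq n q g true :=
    mul_le_mul_of_nonneg_left (min_le_right _ _) h0
  have hm : min (pEq n q g false) (pEq n q g true) =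
      pEq n q f true * min (pEq n q g false) (pEq n q g true) +
        pEq n q f false * min (pEq n q g false) (pEq n q g true) := by
    rw [← add_mul, hsum, one_mul]
  linarith

/-- The `F`-blind clique indicator `CLIQUE_k(x ∖ F)` differs from `CLIQUE_k` only on inputs with a
clique touching `F`. [folklore] -/
theorem pNe_zeroOn_le_pTouch {n k : ℕ} {q : ℝ} (hq0 : 0 ≤ q) (hq1 : q ≤ 1) (F : Finset (Edges n)) :
    pNe n q (fun x => cliqueFn n k (zeroOn F x)) (cliqueFn n k) ≤ pTouch n k q F :=
  gnpProb_mono hq0 hq1 fun x hx => by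
    simp only [mem_filter, mem_univ, true_and] at hx ⊢
    exact touch_of_ne F x hx

/-- `Pr[CLIQUE = 0] ≤ Pr[CLIQUE(· ∖ F) = 0]`. [folklore] -/
theorem pEq_clique_false_le {n k : ℕ} {q : ℝ} (hq0 : 0 ≤ q) (hq1 : q ≤ 1) (F : Finset (Edges n)) :
    pEq n q (cliqueFn n k) false ≤ pEq n q (fun x => cliqueFn n k (zeroOn F x)) false :=
  gnpProb_mono hq0 hq1 fun x hx => by
    simp only [mem_filter, mem_univ, true_and] at hx ⊢
    have hle : cliqueFn n k (zeroOn F x) ≤ cliqueFn n k x := cliqueFn_monotone_holds n k (zeroOn_le F x)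
    rw [hx] at hle
    exact le_antisymm hle (Bool.false_le _)

/-- `Pr[some k-clique touches F] ≤ |F| C(n-2,k-2) q^{C(k,2)}`. [folklore] -/
theorem pTouch_le {n k : ℕ} {q : ℝ} (hq0 : 0 ≤ q) (hq1 : q ≤ 1) (F : Finset (Edges n)) :
    pTouch n k q F ≤ #F * ((n - 2).choose (k - 2) : ℝ) * q ^ (k.choose 2) :=
  gnpProb_clique_touching_le (k := k) F hq0 hq1

/-- **Locality lower bound.** If the circuit `C` only reads edges in `F`, then on `G(n,q)`
`Pr[C ≠ CLIQUE_k] ≥ min(Pr[CLIQUE_k = 0], Pr[CLIQUE_k = 1] - τ) - τ` with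
`τ = Pr[some k-clique touches F] ≤ |F| C(n-2,k-2) q^{C(k,2)}`: the output of `C` is independent of
the `F`-blind indicator `CLIQUE_k(x ∖ F)`, which agrees with `CLIQUE_k` off the touching event.
[folklore] -/
theorem err_ge_of_reads {n k : ℕ} {q : ℝ} (hq0 : 0 ≤ q) (hq1 : q ≤ 1) (C : Circuit (Edges n))
    (F : Finset (Edges n)) (hF : ∀ i ∈ inputList C, i ∈ F) :
    min (pEq n q (cliqueFn n k) false) (pEq n q (cliqueFn n k) true - pTouch n k q F) - pTouch n k q F ≤
      pNe n q (fun x => C.eval x) (cliqueFn n k) := by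
  set g : (Edges n → Bool) → Bool := fun x => cliqueFn n k (zeroOn F x) with hg
  have hf : ∀ x y : Edges n → Bool, (∀ e ∈ F, x e = y e) → C.eval x = C.eval y :=
    fun x y hxy => eval_congr C fun i hi => hxy i (hF i hi)
  have hg' : ∀ x y : Edges n → Bool, (∀ e ∉ F, x e = y e) → g x = g y := by
    intro x y hxy
    simp only [hg]
    rw [zeroOn_congr_off hxy]
  have h1 : pNe n q (fun x => C.eval x) g ≤ pNe n q (fun x => C.eval x) (cliqueFn n k) +
      pNe n q g (cliqueFn n k) := pNe_triangle hq0 hq1 _ _ _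
  have h2 : pNe n q g (cliqueFn n k) ≤ pTouch n k q F := pNe_zeroOn_le_pTouch hq0 hq1 F
  have h3 : min (pEq n q g false) (pEq n q g true) ≤ pNe n q (fun x => C.eval x) g :=
    min_le_pNe_of_indep hq0 hq1 F _ g hf hg'
  have h4 : pEq n q (cliqueFn n k) false ≤ pEq n q g false := pEq_clique_false_le hq0 hq1 F
  have h5 : pEq n q (cliqueFn n k) true ≤ pEq n q g true + pNe n q g (cliqueFn n k) :=
    pEq_le_pEq_add_pNe hq0 hq1 _ g true
  have h6 : min (pEq n q (cliqueFn n k) false) (pEq n q (cliqueFn n k) true - pTouch n k q F) ≤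
      min (pEq n q g false) (pEq n q g true) := min_le_min h4 (by linarith)
  linarith

/-! ### The crux holds below `n²` for free: `LowerBoundAt c k δ` for `c ≤ 1`, every `k ≥ 3` -/

/-- `p_c^{C(k,2)} = n^{-k}`. [folklore] -/
theorem pc_pow_choose {n k : ℕ} (hn : 1 ≤ n) (hk : 2 ≤ k) : pc n k ^ (k.choose 2) = ((n : ℝ) ^ k)⁻¹ := by
  have hn0 : (0 : ℝ) < n := by exact_mod_cast hn
  have hk1 : (k : ℝ) - 1 ≠ 0 := by
    have : (2 : ℝ) ≤ k := by exact_mod_cast hk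
    linarith
  unfold pc
  rw [← Real.rpow_natCast, ← Real.rpow_mul hn0.le, Nat.cast_choose_two]
  have : -2 / ((k : ℝ) - 1) * ((k : ℝ) * ((k : ℝ) - 1) / 2) = -(k : ℝ) := by
    field_simp
  rw [this, Real.rpow_neg hn0.le, Real.rpow_natCast]

/-- The touching budget of a circuit reading `≤ 2n^c + 1` edges vanishes for `c ≤ 1`:
`(2n^c+1) · C(n-2,k-2) · p_c^{C(k,2)} ≤ 3/n`. [folklore] -/
theorem touchBudget_le {n k c : ℕ} (hn : 1 ≤ n) (hk : 2 ≤ k) (hc : c ≤ 1) :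
    (2 * (n : ℝ) ^ c + 1) * ((n - 2).choose (k - 2) : ℝ) * pc n k ^ (k.choose 2) ≤ 3 / n := by
  have hn0 : (0 : ℝ) < n := by exact_mod_cast hn
  rw [pc_pow_choose hn hk]
  have h1 : (2 * (n : ℝ) ^ c + 1) ≤ 3 * n := by
    have : (n : ℝ) ^ c ≤ n := by
      rcases Nat.le_one_iff_eq_zero_or_eq_one.1 hc with rfl | rfl
      · simp; exact_mod_cast hn
      · simp
    have h1' : (1 : ℝ) ≤ n := by exact_mod_cast hn
    linarith
  have h2 : ((n - 2).choose (k - 2) : ℝ) ≤ (n : ℝ) ^ (k - 2) := by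
    have ha : (n - 2).choose (k - 2) ≤ (n - 2) ^ (k - 2) := Nat.choose_le_pow _ _
    have hb : (n - 2) ^ (k - 2) ≤ n ^ (k - 2) := Nat.pow_le_pow_left (Nat.sub_le n 2) _
    exact_mod_cast ha.trans hb
  have hk2 : (n : ℝ) ^ k = (n : ℝ) ^ (k - 2) * n * n := by
    rw [← pow_succ, ← pow_succ]
    congr 1
    omega
  calc (2 * (n : ℝ) ^ c + 1) * ((n - 2).choose (k - 2) : ℝ) * ((n : ℝ) ^ k)⁻¹
      ≤ (3 * n) * (n : ℝ) ^ (k - 2) * ((n : ℝ) ^ k)⁻¹ := by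
        have : 0 ≤ ((n : ℝ) ^ k)⁻¹ := inv_nonneg.2 (pow_nonneg hn0.le _)
        have : (0 : ℝ) ≤ (n - 2).choose (k - 2) := Nat.cast_nonneg _
        gcongr
    _ = 3 / n := by
        rw [hk2]
        field_simp

/-- **Below `n²` the crux holds for free (locality).** For `c ≤ 1` and every `k ≥ 3` there is
`δ > 0` (namely a quarter of the in-tree lower bound `η_k` on `Pr[ω_k = 1]`) such that, eventually,
every monotone circuit of size `≤ n^c` errs with probability `> δ`: it reads `≤ 2n^c + 1 = o(n²)`
edges, which w.h.p. touch no `k`-clique, so its output is independent of `CLIQUE_k`. The contentful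
range of the crux therefore starts at `c = 2`. [folklore] -/
theorem lowerBoundAt_of_le_one {c k : ℕ} (hc : c ≤ 1) (hk : 3 ≤ k) :
    ∃ δ : ℝ, 0 < δ ∧ LowerBoundAt c k δ := by
  have hk2 : 2 ≤ k := by omega
  set η : ℝ := (1 : ℝ) ^ k.choose 2 / (2 ^ k * k.factorial) *
    Real.exp (-(2 * (k * 2 ^ k * (1 : ℝ) ^ k.choose 2))) with hη
  have hη0 : 0 < η := by positivity
  have hηe : η ≤ Real.exp (-2) := by
    have ha : (1 : ℝ) ^ k.choose 2 / (2 ^ k * k.factorial) ≤ 1 := by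
      rw [one_pow, div_le_one (by positivity)]
      have h2 : (1 : ℝ) ≤ 2 ^ k := one_le_pow₀ (by norm_num)
      have h3 : (1 : ℝ) ≤ k.factorial := by exact_mod_cast Nat.one_le_iff_ne_zero.2 (Nat.factorial_ne_zero k)
      nlinarith
    have hb : Real.exp (-(2 * (k * 2 ^ k * (1 : ℝ) ^ k.choose 2))) ≤ Real.exp (-2) := by
      rw [Real.exp_le_exp]
      have h2 : (1 : ℝ) ≤ 2 ^ k := one_le_pow₀ (by norm_num)
      have h3 : (3 : ℝ) ≤ k := by exact_mod_cast hk
      rw [one_pow, mul_one]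
      nlinarith
    calc η = (1 : ℝ) ^ k.choose 2 / (2 ^ k * k.factorial) *
        Real.exp (-(2 * (k * 2 ^ k * (1 : ℝ) ^ k.choose 2))) := hη
      _ ≤ 1 * Real.exp (-2) := by
          gcongr
      _ = Real.exp (-2) := one_mul _
  -- eventual lower bounds on `Pr[ω_k = 1]` and `Pr[ω_k = 0]`
  have hpc1 : ∀ᶠ n : ℕ in atTop, (1 : ℝ) * (n : ℝ) ^ (-(2 : ℝ) / ((k : ℝ) - 1)) ≤ pc n k ∧
      pc n k ≤ 1 * (n : ℝ) ^ (-(2 : ℝ) / ((k : ℝ) - 1)) :=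
    Eventually.of_forall fun n => by simp [pc]
  have h1 := eventually_le_gnpProb_cliqueCount_eq_one hk2 (p := fun n => pc n k) one_pos le_rfl hpc1
  have hpc0 : ∀ᶠ n : ℕ in atTop, 0 ≤ pc n k ∧ pc n k ≤ 1 * (n : ℝ) ^ (-(2 : ℝ) / ((k : ℝ) - 1)) :=
    Eventually.of_forall fun n => ⟨pc_nonneg n k, by simp [pc]⟩
  have h0 := eventually_le_gnpProb_cliqueFree hk2 (p := fun n => pc n k) (b := 1) le_rfl hpc0
  -- the touching budget vanishes
  have hτ : ∀ᶠ n : ℕ in atTop, (3 : ℝ) / n ≤ η / 4 := by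
    have := tendsto_const_div_atTop_nhds_zero_nat (3 : ℝ)
    exact this.eventually (eventually_le_nhds (by positivity))
  refine ⟨η / 4, by positivity, ?_⟩
  filter_upwards [h1, h0, hτ, eventually_ge_atTop 1] with n hn1 hn0 hτn hn
  intro C hC herr
  by_contra hsize
  push Not at hsize
  have hq0 := pc_nonneg n k
  have hq1 := pc_le_one hn hk2
  -- the edges `C` reads
  set F : Finset (Edges n) := (inputList C).toFinset with hF
  have hFmem : ∀ i ∈ inputList C, i ∈ F := fun i hi => List.mem_toFinset.2 hi
  have hFcard : (#F : ℝ) ≤ 2 * (n : ℝ) ^ c + 1 := by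
    have h1 : #F ≤ (inputList C).length := List.toFinset_card_le _
    have h2 := length_inputList_le C (arity_le_two_of_isOver hC)
    have h3 : #F ≤ 2 * n ^ c + 1 := by omega
    exact_mod_cast h3
  -- touching probability
  have hτ' : pTouch n k (pc n k) F ≤ η / 4 := by
    refine (pTouch_le hq0 hq1 F).trans ?_
    refine le_trans ?_ ((touchBudget_le hn hk2 hc).trans hτn)
    have : (0 : ℝ) ≤ ((n - 2).choose (k - 2) : ℝ) * pc n k ^ (k.choose 2) :=
      mul_nonneg (Nat.cast_nonneg _) (pow_nonneg hq0 _)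
    nlinarith
  -- the two constants
  have hPc1 : η ≤ pEq n (pc n k) (cliqueFn n k) true := by
    refine hn1.trans (gnpProb_mono hq0 hq1 fun x hx => ?_)
    simp only [mem_filter, mem_univ, true_and] at hx ⊢
    exact (cliqueCount_ne_zero_iff x).1 (by rw [hx]; exact one_ne_zero)
  have hPc0 : Real.exp (-2) ≤ pEq n (pc n k) (cliqueFn n k) false := by
    have h := hn0
    simp only [one_pow, mul_one] at h
    refine h.trans (gnpProb_mono hq0 hq1 fun x hx => ?_)
    simp only [mem_filter, mem_univ, true_and] at hx ⊢
    exact (cliqueCount_eq_zero_iff x).1 hx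
  -- locality
  have hmain := err_ge_of_reads (k := k) hq0 hq1 C F hFmem
  have herr' : err n k C = pNe n (pc n k) (fun x => C.eval x) (cliqueFn n k) := rfl
  rw [← herr'] at hmain
  have hmin : 3 * η / 4 ≤ min (pEq n (pc n k) (cliqueFn n k) false)
      (pEq n (pc n k) (cliqueFn n k) true - pTouch n k (pc n k) F) :=
    le_min (by linarith) (by linarith)
  linarith

end

end Summit.PneNP.PneNP.Theorems.SingleThreshold.Negative
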